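import Mathlib
import HarnessLib
import Literature.Dynamics.Homogeneous.HorocycleFlow
import Literature.NumberTheory.LFunctions.HorocycleStripFourier
import Literature.NumberTheory.LFunctions.HorocycleRateHalfUnfolding
import Literature.Analysis.FunctionSpaces.SmoothParametricIntegral
import Literature.MeasureTheory.Group.SL2IwasawaHaar

/-!
# Strip test functions on the frame bundle and their arc transforms

Support file (everything PROVED; two definitions, no named facts) for the proof of
`Literature.Dynamics.Homogeneous.flaminioForni_closedHorocycle_modular` (`HorocycleFlow.lean`;
Flaminio–Forni, Duke Math. J. 119 (2003), Prop. 5.15: closed cuspidal horocycles on the modular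
unit tangent bundle `SL(2,ℤ)\SL(2,ℝ)` equidistribute with remainder `O(T^{-1/2} log T)`).

The proof is the frame-bundle version of the tree's ELEMENTARY unfolding proof of the surface case
(`Literature.NumberTheory.LFunctions.zagier_horocycle_rate_half_holds`, files
`HorocycleRateHalf*.lean`, `HorocycleUnfolding.lean`, `HorocyclePhase.lean`): after unfolding the
closed horocycle over `Γ∞\Γ/Γ∞` one meets integrals of a `Γ∞`-invariant test function over the
horocycle ARCS of euclidean diameter `1/w` tangent to `ℝ` at `a/c`, `w = c² y`.  On the frame
bundle the unit tangent vector along such an arc ROTATES, but its direction is a function of the arc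
parameter alone.  We therefore use FRAME COORDINATES: every `g ∈ SL(2,ℝ)` is `n(x) s(c,d)` with
`(c, d)` its bottom row, `x = re (g·i)` and `s(c,d) = (d/r², -c/r²; c, d)`, `r² = c² + d²`
(`HorocycleFlowUnfolding.lean`); a smooth `Γ∞`-invariant function supported in heights
`im (g·i) = 1/r² > 1/2` becomes a smooth `p : ℝ × ℝ × ℝ → ℂ`, `1`-periodic in `x` and vanishing
for `c² + d² ≥ 2` (`IsFrameStripFun`), and the arc of diameter `1/w` at `θ` in the unfolded
parameter `t` is `(θ - t/(w(1+t²)), √w, √w t)` (`frameArcTransform`).  Compared with the surface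
case (`arcTransform g w θ = ∫ g(θ + (-t+i)/(w(1+t²))) dt`, a function of the point only) the only
change is the extra dependence on the direction `(√w, √w t)/r`.

Proved here, for `p` with `IsFrameStripFun p` and `w > 0`:
* `θ ↦ Ψ_p(w,θ)` is continuous, `1`-periodic, `= 0` for `w ≥ 2`;
* its Fourier coefficients are `∫₀¹ Ψ_p(w,θ) e(-kθ) dθ = ∫ e(-k t/(w(1+t²))) p̂_k(√w, √w t) dt`
  (`frameCoeff_eq`, Fubini + shift), where `p̂_k(c,d) = ∫₀¹ p(x,c,d) e(-kx) dx` satisfies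
  `‖p̂_k(c,d)‖ ≤ C/|k|³` uniformly (three integrations by parts in `x`);
* the TRIVIAL arc-length bound `‖∫₀¹ Ψ_p(w,·) e(-k·)‖ ≤ 2 √(2/w) C/|k|³` (support `t² < 2/w`) — this
  is where the logarithm of Flaminio–Forni's remainder comes from (the surface files remove the
  `w^{-1/2}` by a stationary-phase integration by parts in `t`, which we do not need);
* the zero mode `u ∫₀¹ Ψ_p(u², θ) dθ = k₀(u) := ∫_{-2}^{2} ∫₀¹ p(x, u, s) dx ds` (`s = u t`), with
  `k₀` smooth (tree lemma `contDiff_parametric_intervalIntegral`) and `= 0` on `[2, ∞)`;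
* packaged as `IsFrameStripFun.frameArcFourierBound` in the shape consumed by the tree's
  `CoprimeResidueSums.norm_sum_coprime_sub_le` and `HorocycleZeroMode.zeroMode_bound`.

## References
* L. Flaminio, G. Forni, *Invariant distributions and time averages for horocycle flows*, Duke
  Math. J. 119 (2003) 465–526, Prop. 5.15 [FlaminioForni2003].
* P. Sarnak, *Asymptotic behavior of periodic orbits of the horocycle flow and Eisenstein series*,
  Comm. Pure Appl. Math. 34 (1981) 719–739, Thm. 1 [Sarnak1981].
* H. Iwaniec, *Spectral Methods of Automorphic Forms*, 2nd ed., AMS GSM 53 (2002), §2.4, §3.4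
  [Iwaniec2002].

## Mathlib / tree search
Tree: `HorocycleStripFourier.integral_mul_exp_eq_of_periodic`, `summable_of_norm_le_div_cube`,
`hasSum_fourier_of_periodic`; `Literature.Analysis.FunctionSpaces.contDiff_parametric_intervalIntegral`;
Mathlib: `integral_integral_swap_of_hasCompactSupport`, `Measure.integral_comp_mul_left`,
`intervalIntegral.continuous_parametric_intervalIntegral_of_continuous'`.  Nothing on functions on
`SL(2,ℤ)\SL(2,ℝ)` (`lean search 'horocycl|Iwasawa'`: the surface files and `SL2IwasawaHaar`).
-/

noncomputable section

open Complex MeasureTheory Set Filter Topology intervalIntegral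
open scoped Real ContDiff MatrixGroups
open Literature.NumberTheory.LFunctions Literature.NumberTheory.LFunctions.HorocycleStripFourier

namespace Literature.Dynamics.Homogeneous

/-! ### Frame coordinates on `SL(2,ℝ)` -/

/-- **Frame coordinates.** `frameOf x c d = n(x) s(c,d) = (d/r² + xc, -c/r² + xd; c, d)`,
`r² = c² + d²`: the unique element of `SL(2,ℝ)` with bottom row `(c, d)` sitting over a point of
real part `x` (namely `x + i/r²`).  Junk value `1` for `(c, d) = 0`. [folklore] -/
def frameOf (x c d : ℝ) : SL(2, ℝ) :=
  if h : c ^ 2 + d ^ 2 ≠ 0 then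
    ⟨!![d / (c ^ 2 + d ^ 2) + x * c, -c / (c ^ 2 + d ^ 2) + x * d; c, d], by
      rw [Matrix.det_fin_two_of]; field_simp; ring⟩
  else 1

/-- The entries of `frameOf x c d` for `(c, d) ≠ 0`. [folklore] -/
theorem frameOf_coe {x c d : ℝ} (h : c ^ 2 + d ^ 2 ≠ 0) :
    ((frameOf x c d : SL(2, ℝ)) : Matrix (Fin 2) (Fin 2) ℝ) =
      !![d / (c ^ 2 + d ^ 2) + x * c, -c / (c ^ 2 + d ^ 2) + x * d; c, d] := by
  simp [frameOf, h]

/-- The bottom row of an element of `SL(2,ℝ)` does not vanish: `g₁₀² + g₁₁² ≠ 0`. [folklore] -/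
theorem sq_add_sq_ne_zero (g : SL(2, ℝ)) : (g 1 0) ^ 2 + (g 1 1) ^ 2 ≠ 0 := by
  intro h0
  have h1 : g 1 0 = 0 := by nlinarith [sq_nonneg (g 1 0), sq_nonneg (g 1 1)]
  have h2 : g 1 1 = 0 := by nlinarith [sq_nonneg (g 1 0), sq_nonneg (g 1 1)]
  have hdet := g.det_coe
  rw [Matrix.det_fin_two, h1, h2] at hdet
  simp at hdet

/-- **Every `g ∈ SL(2,ℝ)` is `n(x) s(c,d)`** with `(c,d)` its bottom row and
`x = (g₀₀ g₁₀ + g₀₁ g₁₁)/(g₁₀² + g₁₁²) = re (g • i)` (`Literature.MeasureTheory.Group.xOf`).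
[folklore] -/
theorem frameOf_xOf_eq (g : SL(2, ℝ)) :
    frameOf (Literature.MeasureTheory.Group.xOf g) (g 1 0) (g 1 1) = g := by
  have h := sq_add_sq_ne_zero g
  have hdet := g.det_coe
  rw [Matrix.det_fin_two] at hdet
  ext i j
  rw [frameOf_coe h]
  unfold Literature.MeasureTheory.Group.xOf
  fin_cases i <;> fin_cases j
  · simp; field_simp; linear_combination (-(g 1 1)) * hdet
  · simp; field_simp; linear_combination (g 1 0) * hdet
  · simp
  · simp

/-- Translation in `x` is left multiplication by `T = (1,1;0,1)`:
`frameOf (x+1) c d = T · frameOf x c d`. [folklore] -/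
theorem frameOf_add_one {x c d : ℝ} (h : c ^ 2 + d ^ 2 ≠ 0) :
    frameOf (x + 1) c d = ((ModularGroup.T : SL(2, ℤ)) : SL(2, ℝ)) * frameOf x c d := by
  ext i j
  rw [Matrix.SpecialLinearGroup.coe_mul, frameOf_coe h, frameOf_coe h]
  fin_cases i <;> fin_cases j <;> simp [ModularGroup.T, Matrix.mul_apply, Fin.sum_univ_two] <;> ring

/-- The frame `frameOf x c d` sits over the point `x + i/(c² + d²)`. [folklore] -/
theorem coe_frameOf_smul_I {x c d : ℝ} (h : c ^ 2 + d ^ 2 ≠ 0) :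
    ((frameOf x c d • UpperHalfPlane.I : UpperHalfPlane) : ℂ) = ⟨x, 1 / (c ^ 2 + d ^ 2)⟩ := by
  rw [Literature.MeasureTheory.Group.coe_smul_I_eq]
  unfold Literature.MeasureTheory.Group.xOf Literature.MeasureTheory.Group.yOf
  rw [(frameOf x c d).det_coe, frameOf_coe h]
  apply Complex.ext
  · simp; field_simp; ring
  · simp

/-- **The profile of a function on `SL(2,ℝ)`** in frame coordinates, automorphized for `Γ∞`:
`p(x, c, d) = f(n(x) s(c,d)) χ₀(1/r²) / E₀(x + i/r²)`, where `χ₀ = cuspCutoff` (`= 0` below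
height `1/2`) and `E₀ = incEis χ₀ ≥ 1` is the tree's incomplete Eisenstein series
(`HorocycleRateHalfUnfolding.lean`); for a `Γ`-invariant cusp-supported test function `f` this is a
frame strip test function and `f = ∑_{γ ∈ Γ∞\Γ} (p ∘ coords ∘ (γ ·))`
(`HorocycleFlowUnfolding.lean`). [folklore] -/
def frameProfile (f : SL(2, ℝ) → ℂ) (q : ℝ × ℝ × ℝ) : ℂ :=
  f (frameOf q.1 q.2.1 q.2.2) * (cuspCutoff (1 / (q.2.1 ^ 2 + q.2.2 ^ 2)) : ℂ) /
    incEis cuspCutoff ⟨q.1, 1 / (q.2.1 ^ 2 + q.2.2 ^ 2)⟩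

/-- Unfolding the definition of the profile at `(x, c, d)`. [folklore] -/
theorem frameProfile_apply (f : SL(2, ℝ) → ℂ) (x c d : ℝ) :
    frameProfile f (x, c, d) = f (frameOf x c d) * (cuspCutoff (1 / (c ^ 2 + d ^ 2)) : ℂ) /
      incEis cuspCutoff ⟨x, 1 / (c ^ 2 + d ^ 2)⟩ := rfl

/-- **The cells of the partition of unity on the closed horocycle**: for a pair `v = (c, d)`,
`cell_v(u) = f(n(u)a(y)) χ₀(y/|c(u+iy)+d|²) / E₀(u+iy)` (`∑_{(c,d)=1} cell_v = f(n(u)a(y))`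
since `∑ χ₀,v = E₀`). [folklore] -/
def frameCell (f : SL(2, ℝ) → ℂ) (y : ℝ) (v : Fin 2 → ℤ) (u : ℝ) : ℂ :=
  f (modularHorocycleFrame u y) * (incEisTerm cuspCutoff v ((u : ℂ) + y * I) : ℂ) /
    incEis cuspCutoff ((u : ℂ) + y * I)

/-! ### Strip test functions in frame coordinates -/

/-- **Strip test functions in frame coordinates.** `p (x, c, d)` is the value of a `Γ∞`-invariant
test function on `SL(2,ℝ)` at the frame `n(x) s(c,d)` over the point `x + i/(c²+d²)` with direction
`(c, d)/r`; the class asks: `p` smooth on `ℝ³`, `1`-periodic in `x`, and `= 0` for `c² + d² ≥ 2`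
(heights `≤ 1/2`).  Frame-bundle analogue of `Literature.NumberTheory.LFunctions.IsStripFun`.
[folklore] -/
structure IsFrameStripFun (p : ℝ × ℝ × ℝ → ℂ) : Prop where
  smooth : ContDiff ℝ ∞ p
  periodic : ∀ x c d : ℝ, p (x + 1, c, d) = p (x, c, d)
  zero_of_two_le : ∀ x c d : ℝ, 2 ≤ c ^ 2 + d ^ 2 → p (x, c, d) = 0

/-- **Arc transform on the frame bundle**: `Ψ_p(w, θ) = ∫_ℝ p(θ - t/(w(1+t²)), √w, √w t) dt`, the
integral of `p` over the frames tangent to the horocycle of euclidean diameter `1/w` based at the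
cusp `θ`, in the unfolded parameter `t` (the frame `n(θ) a(1/w) w₀ n(t)`, `w₀ = (0,-1;1,0)`, has
bottom row `(√w, √w t)` and sits over `θ + (-t + i)/(w(1+t²))`). [folklore] -/
def frameArcTransform (p : ℝ × ℝ × ℝ → ℂ) (w θ : ℝ) : ℂ :=
  ∫ t : ℝ, p (θ - t / (w * (1 + t ^ 2)), Real.sqrt w, Real.sqrt w * t)

/-- The Fourier coefficients of the `x`-slices: `p̂_k(c,d) = ∫₀¹ p(x,c,d) e(-kx) dx`. [folklore] -/
def frameSliceCoeff (p : ℝ × ℝ × ℝ → ℂ) (k : ℤ) (c d : ℝ) : ℂ :=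
  ∫ x in (0:ℝ)..1, p (x, c, d) * Complex.exp (-(2 * π * I * k * x))

/-- The zero-mode kernel `k₀(u) = ∫_{-2}^{2} ∫₀¹ p(x, u, s) dx ds`. [folklore] -/
def frameZeroKernel (p : ℝ × ℝ × ℝ → ℂ) (u : ℝ) : ℂ :=
  ∫ s in (-2:ℝ)..2, ∫ x in (0:ℝ)..1, p (x, u, s)

namespace IsFrameStripFun

variable {p : ℝ × ℝ × ℝ → ℂ}

/-! ### Periodicity, support, boundedness -/

/-- Continuity. [folklore] -/
theorem continuous (hp : IsFrameStripFun p) : Continuous p := hp.smooth.continuous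

/-- `ℤ`-periodicity in `x`. [folklore] -/
theorem periodic_int (hp : IsFrameStripFun p) (x c d : ℝ) (n : ℤ) : p (x + n, c, d) = p (x, c, d) := by
  have h : Function.Periodic (fun x : ℝ => p (x, c, d)) 1 := fun x => hp.periodic x c d
  have := h.int_mul n x
  simpa using this

/-- Off the disc `c² + d² < 2` the function vanishes; on it `|c|, |d| ≤ 2`. [folklore] -/
theorem abs_le_two_of_ne_zero (hp : IsFrameStripFun p) {x c d : ℝ} (h : p (x, c, d) ≠ 0) :
    |c| ≤ 2 ∧ |d| ≤ 2 := by
  have h2 : c ^ 2 + d ^ 2 < 2 := by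
    by_contra hle; exact h (hp.zero_of_two_le x c d (not_lt.mp hle))
  constructor
  · rw [abs_le]; constructor <;> nlinarith [sq_nonneg d, sq_nonneg (c - 2), sq_nonneg (c + 2)]
  · rw [abs_le]; constructor <;> nlinarith [sq_nonneg c, sq_nonneg (d - 2), sq_nonneg (d + 2)]

/-- **Boundedness**: `‖p‖ ≤ B` (continuity on the compact period box `[0,1] × [-2,2]²` and
periodicity). [folklore] -/
theorem exists_bound (hp : IsFrameStripFun p) : ∃ B : ℝ, 0 ≤ B ∧ ∀ q, ‖p q‖ ≤ B := by
  set K : Set (ℝ × ℝ × ℝ) := Icc (0:ℝ) 1 ×ˢ (Icc (-2:ℝ) 2 ×ˢ Icc (-2:ℝ) 2) with hK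
  have hKc : IsCompact K := isCompact_Icc.prod (isCompact_Icc.prod isCompact_Icc)
  obtain ⟨C, hC⟩ := hKc.exists_bound_of_continuousOn hp.continuous.continuousOn
  refine ⟨max C 0, le_max_right _ _, fun q => ?_⟩
  obtain ⟨x, c, d⟩ := q
  by_cases hz : p (x, c, d) = 0
  · rw [hz, norm_zero]; exact le_max_right _ _
  obtain ⟨hc, hd⟩ := hp.abs_le_two_of_ne_zero hz
  have hmem : (x + ((-⌊x⌋ : ℤ) : ℝ), c, d) ∈ K := by
    refine ⟨⟨?_, ?_⟩, ⟨abs_le.mp hc, abs_le.mp hd⟩⟩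
    · push_cast; linarith [Int.floor_le x]
    · push_cast; linarith [Int.lt_floor_add_one x]
  calc ‖p (x, c, d)‖ = ‖p (x + ((-⌊x⌋ : ℤ) : ℝ), c, d)‖ := by rw [hp.periodic_int]
    _ ≤ C := hC _ hmem
    _ ≤ max C 0 := le_max_left _ _

/-! ### The `x`-derivative stays in the class -/

/-- The slice `x ↦ p(x,c,d)` has derivative `D p (x,c,d) (1,0,0)`. [folklore] -/
theorem hasDerivAt_slice (hp : IsFrameStripFun p) (c d x : ℝ) :
    HasDerivAt (fun x : ℝ => p (x, c, d)) (fderiv ℝ p (x, c, d) (1, 0, 0)) x := by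
  have h1 : HasDerivAt (fun x : ℝ => ((x, c, d) : ℝ × ℝ × ℝ)) ((1 : ℝ), (0 : ℝ × ℝ)) x :=
    (hasDerivAt_id x).prodMk (hasDerivAt_const x (c, d))
  have h2 : HasFDerivAt p (fderiv ℝ p (x, c, d)) (x, c, d) :=
    ((hp.smooth.differentiable (by simp)) _).hasFDerivAt
  exact (h2.comp_hasDerivAt x h1).congr_deriv rfl

/-- `q ↦ D p(q) (1,0,0)` is again a frame strip test function. [folklore] -/
theorem dx (hp : IsFrameStripFun p) : IsFrameStripFun (fun q => fderiv ℝ p q (1, 0, 0)) where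
  smooth := (hp.smooth.fderiv_right (m := ∞) le_rfl).clm_apply contDiff_const
  periodic x c d := by
    have e : ((x + 1, c, d) : ℝ × ℝ × ℝ) = (x, c, d) + (1, 0, 0) := by simp
    have hfun : (fun q : ℝ × ℝ × ℝ => p (q + (1, 0, 0))) = p := by
      funext q; obtain ⟨x', c', d'⟩ := q
      simpa using hp.periodic x' c' d'
    rw [e, ← fderiv_comp_add_right, hfun]
  zero_of_two_le x c d h := by
    have hzero : ∀ t : ℝ, p (t, c, d) = 0 := fun t => hp.zero_of_two_le t c d h
    have h1 : HasDerivAt (fun t : ℝ => p (t, c, d)) (fderiv ℝ p (x, c, d) (1, 0, 0)) x :=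
      hp.hasDerivAt_slice c d x
    have h2 : HasDerivAt (fun t : ℝ => p (t, c, d)) 0 x := by
      have : (fun t : ℝ => p (t, c, d)) = fun _ => 0 := funext hzero
      rw [this]; exact hasDerivAt_const x 0
    exact h1.unique h2

/-! ### Fourier coefficients of the slices -/

/-- `p̂_0(c,d) = ∫₀¹ p(x,c,d) dx`. [folklore] -/
theorem frameSliceCoeff_zero (p : ℝ × ℝ × ℝ → ℂ) (c d : ℝ) :
    frameSliceCoeff p 0 c d = ∫ x in (0:ℝ)..1, p (x, c, d) := by
  simp [frameSliceCoeff]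

/-- The slice coefficients vanish for `c² + d² ≥ 2`. [folklore] -/
theorem frameSliceCoeff_eq_zero (hp : IsFrameStripFun p) (k : ℤ) {c d : ℝ} (h : 2 ≤ c ^ 2 + d ^ 2) :
    frameSliceCoeff p k c d = 0 := by
  simp [frameSliceCoeff, hp.zero_of_two_le _ c d h]

/-- Trivial bound `‖p̂_k(c,d)‖ ≤ B`. [folklore] -/
theorem norm_frameSliceCoeff_le_of_bound {B : ℝ} (hB : ∀ q, ‖p q‖ ≤ B) (k : ℤ) (c d : ℝ) :
    ‖frameSliceCoeff p k c d‖ ≤ B := by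
  have := intervalIntegral.norm_integral_le_of_norm_le_const (a := (0:ℝ)) (b := 1) (C := B)
    (f := fun x : ℝ => p (x, c, d) * Complex.exp (-(2 * π * I * k * x))) (fun x _ => by
      rw [norm_mul, norm_exp_neg_two_pi_mul, mul_one]; exact hB _)
  simpa [frameSliceCoeff] using this

/-- One integration by parts: `p̂_k = (2πik)⁻¹ (∂ₓp)^_k` for `k ≠ 0`. [folklore] -/
theorem frameSliceCoeff_eq_dx (hp : IsFrameStripFun p) {k : ℤ} (hk : k ≠ 0) (c d : ℝ) :
    frameSliceCoeff p k c d =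
      (1 / (2 * π * I * k)) * frameSliceCoeff (fun q => fderiv ℝ p q (1, 0, 0)) k c d := by
  unfold frameSliceCoeff
  have hc : Continuous fun x : ℝ => fderiv ℝ p (x, c, d) (1, 0, 0) :=
    hp.dx.continuous.comp (by fun_prop)
  have hper : p ((1:ℝ), c, d) = p ((0:ℝ), c, d) := by
    have := hp.periodic 0 c d; simpa using this
  exact integral_mul_exp_eq_of_periodic (fun x => hp.hasDerivAt_slice c d x) hc hper hk

/-- **Decay of the slice coefficients**, uniformly in the direction/height variables:
`‖p̂_k(c,d)‖ ≤ C/|k|³` for `k ≠ 0` (three integrations by parts; `C` bounds `∂ₓ³ p`). [folklore] -/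
theorem exists_norm_frameSliceCoeff_le (hp : IsFrameStripFun p) :
    ∃ C : ℝ, 0 ≤ C ∧ ∀ (c d : ℝ) (k : ℤ), k ≠ 0 → ‖frameSliceCoeff p k c d‖ ≤ C / |(k : ℝ)| ^ 3 := by
  set p₁ : ℝ × ℝ × ℝ → ℂ := fun q => fderiv ℝ p q (1, 0, 0) with hp₁_def
  set p₂ : ℝ × ℝ × ℝ → ℂ := fun q => fderiv ℝ p₁ q (1, 0, 0) with hp₂_def
  set p₃ : ℝ × ℝ × ℝ → ℂ := fun q => fderiv ℝ p₂ q (1, 0, 0) with hp₃_def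
  have hp₁ : IsFrameStripFun p₁ := hp.dx
  have hp₂ : IsFrameStripFun p₂ := hp₁.dx
  have hp₃ : IsFrameStripFun p₃ := hp₂.dx
  obtain ⟨C, hC0, hC⟩ := hp₃.exists_bound
  refine ⟨C, hC0, fun c d k hk => ?_⟩
  rw [hp.frameSliceCoeff_eq_dx hk, hp₁.frameSliceCoeff_eq_dx hk, hp₂.frameSliceCoeff_eq_dx hk]
  have hI3 : ‖frameSliceCoeff p₃ k c d‖ ≤ C := norm_frameSliceCoeff_le_of_bound hC k c d
  have hk' : (0:ℝ) < |(k : ℝ)| := abs_pos.mpr (Int.cast_ne_zero.mpr hk)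
  have hc : ‖(1 / (2 * π * I * k) : ℂ)‖ ≤ 1 / |(k : ℝ)| := by
    have e : ‖(1 / (2 * π * I * k) : ℂ)‖ = 1 / (2 * π * |(k : ℝ)|) := by
      simp [abs_of_pos Real.pi_pos]
    rw [e, div_le_div_iff₀ (by positivity) hk', one_mul, one_mul]
    nlinarith [Real.pi_gt_three]
  rw [norm_mul, norm_mul, norm_mul]
  calc ‖(1 / (2 * π * I * k) : ℂ)‖ * (‖(1 / (2 * π * I * k) : ℂ)‖ * (‖(1 / (2 * π * I * k) : ℂ)‖ *
      ‖frameSliceCoeff p₃ k c d‖))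
      ≤ (1 / |(k : ℝ)|) * ((1 / |(k : ℝ)|) * ((1 / |(k : ℝ)|) * C)) := by gcongr
    _ = C / |(k : ℝ)| ^ 3 := by field_simp

/-- The zero slice coefficient `(c,d) ↦ ∫₀¹ p(x,c,d) dx` is smooth. [folklore] -/
theorem contDiff_sliceAverage (hp : IsFrameStripFun p) :
    ContDiff ℝ ∞ fun v : ℝ × ℝ => ∫ x in (0:ℝ)..1, p (x, v.1, v.2) :=
  Literature.Analysis.FunctionSpaces.contDiff_parametric_intervalIntegral (H := p) hp.smooth 0 1

/-! ### The arc transform: support, periodicity, continuity -/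

/-- On the support of the arc integrand: `t² < 2/w`, i.e. `w (1 + t²) < 2`. [folklore] -/
theorem mul_one_add_sq_lt_of_ne_zero (hp : IsFrameStripFun p) {w : ℝ} (hw : 0 < w) {θ t : ℝ}
    (h : p (θ - t / (w * (1 + t ^ 2)), Real.sqrt w, Real.sqrt w * t) ≠ 0) : w * (1 + t ^ 2) < 2 := by
  by_contra hle
  apply h
  apply hp.zero_of_two_le
  have hs : Real.sqrt w ^ 2 = w := Real.sq_sqrt hw.le
  nlinarith [hs, not_lt.mp hle]

/-- … hence `|t| < √(2/w)`. [folklore] -/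
theorem abs_lt_of_ne_zero (hp : IsFrameStripFun p) {w : ℝ} (hw : 0 < w) {θ t : ℝ}
    (h : p (θ - t / (w * (1 + t ^ 2)), Real.sqrt w, Real.sqrt w * t) ≠ 0) :
    |t| < Real.sqrt (2 / w) := by
  have := hp.mul_one_add_sq_lt_of_ne_zero hw h
  rw [← Real.sqrt_sq_eq_abs]
  apply Real.sqrt_lt_sqrt (sq_nonneg t)
  rw [lt_div_iff₀ hw]; nlinarith

/-- For `w ≥ 2` the arc integrand vanishes identically. [folklore] -/
theorem apply_arc_eq_zero_of_two_le (hp : IsFrameStripFun p) {w : ℝ} (hw : 2 ≤ w) (θ t : ℝ) :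
    p (θ - t / (w * (1 + t ^ 2)), Real.sqrt w, Real.sqrt w * t) = 0 := by
  by_contra h
  have := hp.mul_one_add_sq_lt_of_ne_zero (by linarith) h
  nlinarith [sq_nonneg t]

/-- For `w ≥ 2` the arc transform vanishes. [folklore] -/
theorem frameArcTransform_eq_zero_of_two_le (hp : IsFrameStripFun p) {w : ℝ} (hw : 2 ≤ w) (θ : ℝ) :
    frameArcTransform p w θ = 0 := by
  simp [frameArcTransform, hp.apply_arc_eq_zero_of_two_le hw θ]

/-- Joint continuity of the arc point `(θ, t) ↦ (θ - t/(w(1+t²)), √w, √w t)`. [folklore] -/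
theorem continuous_arcPt (w : ℝ) :
    Continuous fun q : ℝ × ℝ => ((q.1 - q.2 / (w * (1 + q.2 ^ 2)), Real.sqrt w, Real.sqrt w * q.2) :
      ℝ × ℝ × ℝ) := by
  rcases eq_or_ne w 0 with rfl | hw
  · simp only [zero_mul, div_zero, sub_zero]; fun_prop
  · refine Continuous.prodMk (continuous_fst.sub (continuous_snd.div (by fun_prop) fun q => ?_))
      (by fun_prop)
    have : 0 < 1 + q.2 ^ 2 := by positivity
    exact mul_ne_zero hw this.ne'

/-- Continuity of the arc integrand in `t`. [folklore] -/
theorem continuous_apply_arc (hp : IsFrameStripFun p) (w θ : ℝ) :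
    Continuous fun t : ℝ => p (θ - t / (w * (1 + t ^ 2)), Real.sqrt w, Real.sqrt w * t) :=
  hp.continuous.comp ((continuous_arcPt w).comp (Continuous.prodMk_right θ))

/-- Outside `|t| < √(2/w)` the arc integrand vanishes. [folklore] -/
theorem apply_arc_eq_zero_of_sqrt_le (hp : IsFrameStripFun p) {w : ℝ} (hw : 0 < w) {θ t : ℝ}
    (ht : Real.sqrt (2 / w) ≤ |t|) : p (θ - t / (w * (1 + t ^ 2)), Real.sqrt w, Real.sqrt w * t) = 0 := by
  by_contra h
  exact absurd (hp.abs_lt_of_ne_zero hw h) (not_lt.mpr ht)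

/-- The arc integrand has compact support in `t`. [folklore] -/
theorem hasCompactSupport_apply_arc (hp : IsFrameStripFun p) {w : ℝ} (hw : 0 < w) (θ : ℝ) :
    HasCompactSupport fun t : ℝ => p (θ - t / (w * (1 + t ^ 2)), Real.sqrt w, Real.sqrt w * t) := by
  refine HasCompactSupport.intro (isCompact_Icc (a := -Real.sqrt (2 / w)) (b := Real.sqrt (2 / w)))
    fun t ht => ?_
  apply hp.apply_arc_eq_zero_of_sqrt_le hw
  rw [Set.mem_Icc, not_and_or, not_le, not_le] at ht
  rcases ht with ht | ht
  · rw [abs_of_neg (by linarith [Real.sqrt_nonneg (2 / w)])]; linarith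
  · rw [abs_of_pos (by linarith [Real.sqrt_nonneg (2 / w)])]; linarith

/-- … hence it is integrable. [folklore] -/
theorem integrable_apply_arc (hp : IsFrameStripFun p) {w : ℝ} (hw : 0 < w) (θ : ℝ) :
    Integrable fun t : ℝ => p (θ - t / (w * (1 + t ^ 2)), Real.sqrt w, Real.sqrt w * t) :=
  (hp.continuous_apply_arc w θ).integrable_of_hasCompactSupport (hp.hasCompactSupport_apply_arc hw θ)

/-- The arc transform as an integral over `[-T, T]`, `T ≥ √(2/w)`. [folklore] -/
theorem frameArcTransform_eq_intervalIntegral (hp : IsFrameStripFun p) {w : ℝ} (hw : 0 < w) (θ : ℝ)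
    {T : ℝ} (hT : Real.sqrt (2 / w) ≤ T) :
    frameArcTransform p w θ =
      ∫ t in (-T)..T, p (θ - t / (w * (1 + t ^ 2)), Real.sqrt w, Real.sqrt w * t) := by
  symm
  apply intervalIntegral.integral_eq_integral_of_support_subset
  intro t ht
  rw [Function.mem_support] at ht
  have := hp.abs_lt_of_ne_zero hw ht
  rw [abs_lt] at this
  exact ⟨by linarith, by linarith⟩

/-- `θ ↦ Ψ_p(w, θ)` is `1`-periodic. [folklore] -/
theorem frameArcTransform_add_one (hp : IsFrameStripFun p) (w θ : ℝ) :
    frameArcTransform p w (θ + 1) = frameArcTransform p w θ := by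
  unfold frameArcTransform
  congr 1; ext t
  rw [show θ + 1 - t / (w * (1 + t ^ 2)) = (θ - t / (w * (1 + t ^ 2))) + 1 by ring, hp.periodic]

/-- `θ ↦ Ψ_p(w, θ)` is continuous (`w > 0`). [folklore] -/
theorem continuous_frameArcTransform (hp : IsFrameStripFun p) {w : ℝ} (hw : 0 < w) :
    Continuous fun θ : ℝ => frameArcTransform p w θ := by
  have e : (fun θ : ℝ => frameArcTransform p w θ) = fun θ : ℝ =>
      ∫ t in (-Real.sqrt (2 / w))..Real.sqrt (2 / w),
        p (θ - t / (w * (1 + t ^ 2)), Real.sqrt w, Real.sqrt w * t) := by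
    ext θ; exact hp.frameArcTransform_eq_intervalIntegral hw θ le_rfl
  rw [e]
  refine intervalIntegral.continuous_parametric_intervalIntegral_of_continuous' ?_ _ _
  exact hp.continuous.comp (continuous_arcPt w)

/-! ### Fourier coefficients of the arc transform -/

/-- The inner `θ`-integral: `∫₀¹ p(θ - s, c, d) e(-kθ) dθ = e(-ks) p̂_k(c,d)` (shift and
`1`-periodicity). [folklore] -/
theorem inner_integral_eq (hp : IsFrameStripFun p) (k : ℤ) (s c d : ℝ) :
    ∫ θ in (0:ℝ)..1, p (θ - s, c, d) * Complex.exp (-(2 * π * I * k * θ)) =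
      Complex.exp (-(2 * π * I * k * s)) * frameSliceCoeff p k c d := by
  set H : ℝ → ℂ := fun x => p (x, c, d) * Complex.exp (-(2 * π * I * k * x)) with hH
  have hHp : Function.Periodic H 1 := by
    intro x
    simp only [hH]
    rw [hp.periodic]
    congr 1
    rw [Complex.exp_eq_exp_iff_exists_int]
    exact ⟨-k, by push_cast; ring⟩
  have hint : ∀ θ : ℝ, p (θ - s, c, d) * Complex.exp (-(2 * π * I * k * θ)) =
      H (θ - s) * Complex.exp (-(2 * π * I * k * s)) := by
    intro θ
    have e2 : Complex.exp (-(2 * π * I * k * θ)) =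
        Complex.exp (-(2 * π * I * k * ((θ - s : ℝ) : ℂ))) * Complex.exp (-(2 * π * I * k * s)) := by
      rw [← Complex.exp_add]; congr 1; push_cast; ring
    rw [e2]; simp only [hH]; ring
  simp_rw [hint]
  rw [intervalIntegral.integral_mul_const, intervalIntegral.integral_comp_sub_right H s,
    show (0 : ℝ) - s = -s by ring, show (1 : ℝ) - s = -s + 1 by ring,
    hHp.intervalIntegral_add_eq (-s) 0, zero_add, mul_comm]
  rfl

/-- **Fourier coefficients of the arc transform** (`w > 0`):
`∫₀¹ Ψ_p(w,θ) e(-kθ) dθ = ∫_ℝ e(-k t/(w(1+t²))) p̂_k(√w, √w t) dt` (Fubini over `[0,1] × ℝ` for the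
continuous compactly supported integrand, then the shift `x = θ - t/(w(1+t²))`). [folklore] -/
theorem frameCoeff_eq (hp : IsFrameStripFun p) {w : ℝ} (hw : 0 < w) (k : ℤ) :
    ∫ θ in (0:ℝ)..1, frameArcTransform p w θ * Complex.exp (-(2 * π * I * k * θ)) =
      ∫ t : ℝ, Complex.exp (-(2 * π * I * k * ((t / (w * (1 + t ^ 2)) : ℝ)))) *
        frameSliceCoeff p k (Real.sqrt w) (Real.sqrt w * t) := by
  -- the two-variable integrand and a bump in `θ` equal to `1` on `[0, 1]`
  set F : ℝ → ℝ → ℂ := fun θ t =>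
    p (θ - t / (w * (1 + t ^ 2)), Real.sqrt w, Real.sqrt w * t) * Complex.exp (-(2 * π * I * k * θ))
    with hF
  let χ : ContDiffBump (1 / 2 : ℝ) := ⟨1 / 2, 1, by norm_num, by norm_num⟩
  set G : ℝ → ℝ → ℂ := fun θ t => ((χ θ : ℝ) : ℂ) * F θ t with hG
  have hχ1 : ∀ θ ∈ Ioc (0:ℝ) 1, (χ θ : ℝ) = 1 := fun θ hθ =>
    χ.one_of_mem_closedBall (by
      rw [Metric.mem_closedBall, Real.dist_eq, abs_le]
      constructor <;> linarith [hθ.1, hθ.2])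
  -- Step 1: move the character inside and insert the bump
  have step1 : ∫ θ in (0:ℝ)..1, frameArcTransform p w θ * Complex.exp (-(2 * π * I * k * θ)) =
      ∫ θ in Ioc (0:ℝ) 1, ∫ t : ℝ, G θ t := by
    rw [intervalIntegral.integral_of_le zero_le_one]
    refine setIntegral_congr_fun measurableSet_Ioc fun θ hθ => ?_
    simp only [hG, hF, hχ1 θ hθ, ofReal_one, one_mul, frameArcTransform]
    exact (MeasureTheory.integral_mul_const _ _).symm
  -- Step 2: Fubini for the continuous compactly supported `G`
  have hGc : Continuous (Function.uncurry G) := by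
    simp only [hG, hF]
    refine ((Complex.continuous_ofReal.comp (χ.continuous.comp continuous_fst)).mul
      ((hp.continuous.comp (continuous_arcPt w)).mul ?_))
    fun_prop
  have hGs : HasCompactSupport (Function.uncurry G) := by
    refine HasCompactSupport.intro ((isCompact_Icc (a := -(1:ℝ)) (b := 2)).prod
      (isCompact_Icc (a := -Real.sqrt (2 / w)) (b := Real.sqrt (2 / w)))) ?_
    rintro ⟨θ, t⟩ hθt
    simp only [Function.uncurry_apply_pair, hG, hF]
    rw [Set.mem_prod, not_and_or] at hθt
    rcases hθt with hθ | ht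
    · have : (χ θ : ℝ) = 0 := by
        apply χ.zero_of_le_dist
        rw [Real.dist_eq]
        rw [Set.mem_Icc, not_and_or, not_le, not_le] at hθ
        change (1:ℝ) ≤ |θ - 1 / 2|
        rcases hθ with hθ | hθ
        · rw [abs_of_neg (by linarith)]; linarith
        · rw [abs_of_pos (by linarith)]; linarith
      rw [this]; simp
    · have : p (θ - t / (w * (1 + t ^ 2)), Real.sqrt w, Real.sqrt w * t) = 0 := by
        apply hp.apply_arc_eq_zero_of_sqrt_le hw
        rw [Set.mem_Icc, not_and_or, not_le, not_le] at ht
        rcases ht with ht | ht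
        · rw [abs_of_neg (by linarith [Real.sqrt_nonneg (2 / w)])]; linarith
        · rw [abs_of_pos (by linarith [Real.sqrt_nonneg (2 / w)])]; linarith
      rw [this]; simp
  have step2 : ∫ θ in Ioc (0:ℝ) 1, ∫ t : ℝ, G θ t = ∫ t : ℝ, ∫ θ in Ioc (0:ℝ) 1, G θ t :=
    integral_integral_swap_of_hasCompactSupport hGc hGs
  -- Step 3: remove the bump and evaluate the inner integral
  have step3 : ∀ t : ℝ, ∫ θ in Ioc (0:ℝ) 1, G θ t =
      Complex.exp (-(2 * π * I * k * ((t / (w * (1 + t ^ 2)) : ℝ)))) *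
        frameSliceCoeff p k (Real.sqrt w) (Real.sqrt w * t) := by
    intro t
    rw [← hp.inner_integral_eq k (t / (w * (1 + t ^ 2))) (Real.sqrt w) (Real.sqrt w * t),
      intervalIntegral.integral_of_le zero_le_one]
    refine setIntegral_congr_fun measurableSet_Ioc fun θ hθ => ?_
    simp only [hG, hF, hχ1 θ hθ, ofReal_one, one_mul]
  rw [step1, step2]
  exact integral_congr_ae (ae_of_all _ step3)

/-- **The trivial arc-length bound**: `‖∫₀¹ Ψ_p(w,·) e(-k·)‖ ≤ 2 √(2/w) C/|k|³` for `k ≠ 0`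
(`C` from `exists_norm_frameSliceCoeff_le`; the `t`-support has length `2√(2/w)`).  The factor
`w^{-1/2} = 1/(c √y)` summed over the rows `c` is the logarithm in Flaminio–Forni's remainder
`O(T^{-1/2} log T)`. [folklore] -/
theorem norm_frameCoeff_le (hp : IsFrameStripFun p) {C : ℝ}
    (hC : ∀ (c d : ℝ) (k : ℤ), k ≠ 0 → ‖frameSliceCoeff p k c d‖ ≤ C / |(k : ℝ)| ^ 3)
    {w : ℝ} (hw : 0 < w) {k : ℤ} (hk : k ≠ 0) :
    ‖∫ θ in (0:ℝ)..1, frameArcTransform p w θ * Complex.exp (-(2 * π * I * k * θ))‖ ≤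
      2 * Real.sqrt (2 / w) * C / |(k : ℝ)| ^ 3 := by
  rw [hp.frameCoeff_eq hw k]
  set T : ℝ := Real.sqrt (2 / w) with hT
  have hT0 : 0 ≤ T := Real.sqrt_nonneg _
  set g : ℝ → ℂ := fun t => Complex.exp (-(2 * π * I * k * ((t / (w * (1 + t ^ 2)) : ℝ)))) *
    frameSliceCoeff p k (Real.sqrt w) (Real.sqrt w * t) with hg
  have hsupp : ∀ t, T ≤ |t| → g t = 0 := by
    intro t ht
    simp only [hg]
    have : frameSliceCoeff p k (Real.sqrt w) (Real.sqrt w * t) = 0 := by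
      apply hp.frameSliceCoeff_eq_zero
      have hs : Real.sqrt w ^ 2 = w := Real.sq_sqrt hw.le
      have h2 : 2 / w ≤ t ^ 2 := by
        have := Real.sqrt_le_sqrt (show (0:ℝ) ≤ 2 / w by positivity) |>.trans ht
        rw [← Real.sqrt_sq_eq_abs] at ht
        have h' : Real.sqrt (2 / w) ^ 2 ≤ Real.sqrt (t ^ 2) ^ 2 := by gcongr
        rwa [Real.sq_sqrt (by positivity), Real.sq_sqrt (sq_nonneg t)] at h'
      rw [div_le_iff₀ hw] at h2
      nlinarith
    rw [this, mul_zero]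
  have heq : ∫ t, g t = ∫ t in (-T)..T, g t := by
    symm
    apply intervalIntegral.integral_eq_integral_of_support_subset
    intro t ht
    rw [Function.mem_support] at ht
    by_contra hmem
    rw [Set.mem_Ioc, not_and_or, not_lt, not_le] at hmem
    apply ht
    apply hsupp
    rcases hmem with h | h
    · rw [abs_of_nonpos (by linarith)]; linarith
    · rw [abs_of_pos (by linarith)]; linarith
  rw [heq]
  have hbound : ∀ t ∈ Set.uIoc (-T) T, ‖g t‖ ≤ C / |(k : ℝ)| ^ 3 := by
    intro t _
    simp only [hg]
    rw [norm_mul, norm_exp_neg_two_pi_mul, one_mul]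
    exact hC _ _ k hk
  calc ‖∫ t in (-T)..T, g t‖ ≤ C / |(k : ℝ)| ^ 3 * |T - -T| :=
        intervalIntegral.norm_integral_le_of_norm_le_const hbound
    _ = 2 * T * C / |(k : ℝ)| ^ 3 := by
        rw [show T - -T = 2 * T by ring, abs_of_nonneg (show (0:ℝ) ≤ 2 * T by linarith)]
        ring

/-! ### The zero mode -/

/-- The zero-mode kernel is smooth. [folklore] -/
theorem contDiff_frameZeroKernel (hp : IsFrameStripFun p) : ContDiff ℝ ∞ (frameZeroKernel p) := by
  have h1 := hp.contDiff_sliceAverage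
  have h2 : ContDiff ℝ ∞ fun q : ℝ × ℝ => ∫ x in (0:ℝ)..1, p (x, q.2, q.1) :=
    h1.comp (contDiff_snd.prodMk contDiff_fst)
  exact Literature.Analysis.FunctionSpaces.contDiff_parametric_intervalIntegral
    (H := fun q : ℝ × ℝ => ∫ x in (0:ℝ)..1, p (x, q.2, q.1)) h2 (-2) 2

/-- The zero-mode kernel vanishes on `[2, ∞)` (indeed for `u² ≥ 2`). [folklore] -/
theorem frameZeroKernel_eq_zero (hp : IsFrameStripFun p) {u : ℝ} (hu : 2 ≤ u) :
    frameZeroKernel p u = 0 := by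
  unfold frameZeroKernel
  have h0 : ∀ s x : ℝ, p (x, u, s) = 0 := fun s x =>
    hp.zero_of_two_le x u s (by nlinarith [sq_nonneg s])
  simp [h0]

/-- Support of the zero-mode integrand: `∫₀¹ p(x,u,s) dx ≠ 0` forces `|s| < 2`. [folklore] -/
theorem abs_lt_two_of_sliceAverage_ne_zero (hp : IsFrameStripFun p) {u s : ℝ}
    (h : (∫ x in (0:ℝ)..1, p (x, u, s)) ≠ 0) : |s| < 2 := by
  by_contra hs
  apply h
  have h0 : ∀ x : ℝ, p (x, u, s) = 0 := fun x =>
    hp.zero_of_two_le x u s (by nlinarith [sq_nonneg u, sq_abs s, abs_nonneg s, not_lt.mp hs])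
  simp [h0]

/-- **The zero mode.** For `u > 0`, `u ∫₀¹ Ψ_p(u², θ) dθ = k₀(u)` (the `k = 0` case of
`frameCoeff_eq`, then `s = u t`). [folklore] -/
theorem mul_frameCoeff_zero_eq (hp : IsFrameStripFun p) {u : ℝ} (hu : 0 < u) :
    (u : ℂ) * ∫ θ in (0:ℝ)..1, frameArcTransform p (u ^ 2) θ *
        Complex.exp (-(2 * π * I * ((0:ℤ) : ℂ) * θ)) = frameZeroKernel p u := by
  rw [hp.frameCoeff_eq (pow_pos hu 2) 0]
  simp only [Int.cast_zero, mul_zero, zero_mul, neg_zero, Complex.exp_zero, one_mul,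
    frameSliceCoeff_zero, Real.sqrt_sq hu.le]
  set φ : ℝ → ℂ := fun s => ∫ x in (0:ℝ)..1, p (x, u, s) with hφ
  have hsub : ∫ t : ℝ, (∫ x in (0:ℝ)..1, p (x, u, u * t)) = |u⁻¹| • ∫ s, φ s := by
    rw [← Measure.integral_comp_mul_left φ u]
  rw [hsub, abs_of_pos (inv_pos.mpr hu), Complex.real_smul, ← mul_assoc, ← ofReal_mul,
    mul_inv_cancel₀ hu.ne', ofReal_one, one_mul]
  unfold frameZeroKernel
  symm
  apply intervalIntegral.integral_eq_integral_of_support_subset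
  intro s hs
  rw [Function.mem_support] at hs
  have := hp.abs_lt_two_of_sliceAverage_ne_zero hs
  rw [abs_lt] at this
  exact ⟨this.1, this.2.le⟩

/-! ### Packaging -/

/-- **Fourier analysis of the frame arc transform** in the shape consumed by the tree's
`CoprimeResidueSums.norm_sum_coprime_sub_le` and `HorocycleZeroMode.zeroMode_bound`: with
`b_k(w) = ∫₀¹ Ψ_p(w,·) e(-k·)`, for `w > 0` one has `Ψ_p(w,θ) = ∑_k b_k(w) e(kθ)` pointwise,
`∑ |b_k(w)| < ∞`, the bound `‖b_k(w)‖ ≤ (M/√w)/|k|³` (`k ≠ 0`), and the zero mode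
`u b₀(u²) = k₀(u)` with `k₀` of class `C²`, `= 0` on `[2,∞)`. [folklore] -/
theorem frameArcFourierBound (hp : IsFrameStripFun p) :
    ∃ (b : ℤ → ℝ → ℂ) (M : ℝ), 0 ≤ M ∧
      (∀ w : ℝ, 0 < w → ∀ θ : ℝ,
        HasSum (fun k : ℤ => b k w * Complex.exp (2 * π * I * k * θ)) (frameArcTransform p w θ)) ∧
      (∀ w : ℝ, 0 < w → Summable fun k : ℤ => b k w) ∧
      (∀ w : ℝ, 0 < w → ∀ k : ℤ, k ≠ 0 → ‖b k w‖ ≤ M / Real.sqrt w / |(k : ℝ)| ^ 3) ∧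
      ∃ k₀ : ℝ → ℂ, ContDiff ℝ 2 k₀ ∧ (∀ s : ℝ, 2 ≤ s → k₀ s = 0) ∧
        ∀ u : ℝ, 0 < u → (u : ℂ) * b 0 (u ^ 2) = k₀ u := by
  obtain ⟨C, hC0, hC⟩ := hp.exists_norm_frameSliceCoeff_le
  set b : ℤ → ℝ → ℂ := fun k w =>
    ∫ θ in (0:ℝ)..1, frameArcTransform p w θ * Complex.exp (-(2 * π * I * k * θ)) with hb
  have hbd : ∀ w : ℝ, 0 < w → ∀ k : ℤ, k ≠ 0 →
      ‖b k w‖ ≤ 2 * Real.sqrt 2 * C / Real.sqrt w / |(k : ℝ)| ^ 3 := by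
    intro w hw k hk
    have h := hp.norm_frameCoeff_le hC hw hk
    have e : 2 * Real.sqrt (2 / w) * C / |(k : ℝ)| ^ 3 = 2 * Real.sqrt 2 * C / Real.sqrt w / |(k : ℝ)| ^ 3 := by
      rw [Real.sqrt_div' 2 hw.le]; ring
    simpa only [hb, e] using h
  have hsumm : ∀ w : ℝ, 0 < w → Summable fun k : ℤ => b k w := fun w hw =>
    summable_of_norm_le_div_cube fun k hk => hbd w hw k hk
  refine ⟨b, 2 * Real.sqrt 2 * C, by positivity, fun w hw θ => ?_, hsumm, hbd,
    frameZeroKernel p, contDiff_infty.1 hp.contDiff_frameZeroKernel 2,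
    fun s hs => hp.frameZeroKernel_eq_zero hs, fun u hu => ?_⟩
  · exact hasSum_fourier_of_periodic (Φ := fun θ : ℝ => frameArcTransform p w θ)
      (hp.continuous_frameArcTransform hw) (fun x => hp.frameArcTransform_add_one w x) (hsumm w hw) θ
  · have := hp.mul_frameCoeff_zero_eq hu
    simpa only [hb] using this

end IsFrameStripFun

end Literature.Dynamics.Homogeneous

end
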